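import Summits.HodgeConjecture.HodgeCM.PerL34.SiegelWeil_1

/-! PORT of `HodgeCM/PerL34/SiegelWeil.lean` (HodgeCMPerL run 81) — part 2: continuation of `Summits.HodgeConjecture.HodgeCM.PerL34.SiegelWeil_1` (split at a top-level declaration boundary by port_pkg.py; scope re-opened below; declarations unchanged). -/

-- port_pkg: scope re-opened for this part (file-level context, then the namespace/section stack open at the cut)
open MeasureTheory Complex ComplexConjugate
namespace HodgeCM.PerL34.N31d
open DoublingKernelData
/-- **N31d from print** (L2 honest split): X₁ (GQT Thm 7.1 = We65 Thm 5 in Weil's range) ∧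
X₂a (GQT §11.3) ∧ X₂b (Li92 (11)–(15)) ∧ |χ_V| = 1 ∧ automorphy ⟹ N31d. -/
theorem N31d_statement_holds (D : DoublingKernelData) (P : D.PrintInputs) :
    N31d_statement D := by
  obtain ⟨c, hc, h⟩ := kernel_identity P
  refine ⟨c, hc, fun φ u u' => ⟨(h φ u u').1, ?_⟩⟩
  rw [(h φ u u').1, (h φ u u').2]
  ring

/-- The conjugate-symmetric form N31e actually substitutes (l. 591–594): with |χ_V| = 1 the
prefactor χ_V(u′)⁻¹ is conj χ_V(u′). -/
theorem N31d_statement_conj_form (D : DoublingKernelData) (P : D.PrintInputs) :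
    ∃ c : ℝ, 0 < c ∧ ∀ (φ : D.S) (u u' : D.UA),
      ∫ x, D.θ φ x u * conj (D.θ φ x u') ∂D.μ
        = (c : ℂ) * conj (D.χV u') * D.E (D.δ φ φ) (D.ι u u') := by
  obtain ⟨c, hc, h⟩ := N31d_statement_holds D P
  exact ⟨c, hc, fun φ u u' => by rw [(h φ u u').2, χV_inv_eq_conj P]⟩

end HodgeCM.PerL34.N31d
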